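import Literature.MathematicalPhysics.QuantumFieldTheory.Balaban1983to89.Node00.CriticalOnFibreTopHalving
import Literature.MathematicalPhysics.QuantumFieldTheory.Balaban1983to89.Node00.LocalGaugeCoDivergenceLetters
import Literature.MathematicalPhysics.QuantumFieldTheory.Balaban1983to89.Node00.TorusCoverGaugeLift

/-!
# NODE 00 — [15] SECT. F's ONE-STEP IMPROVEMENT AT THE OBJECTS OF RECORD, CORE FORM: the named fact `HalvingStepTop F N Sup B₃ a₀ a₁`
# (module 30) with its conclusion asked ONLY where print's analysis acts — at the plaquettes carrying a bond inside `Ω₁` and at the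
# bonds whose co-divergence stencil meets `Ω₁` —; the pure-data remainder is bookkeeping (Summits-side sequel)

Cell `pub-ymgap`, seat `pub-ymgap-k0-s1-w3` generation 0 (D-0149 width seat 3∕3 on K0⁷ `stmt-QuantumFields-20541`, V18 stub 1
`stub_prop8StepCoP13`; plan g77 W-SEAT-START-LIST v3 row k0-s1, INTENT-1 of 2026-08-27).  NEW leaf; CONSUMED BY NAME, nothing modified:
dag-n07-e's module 30 `Node00.CriticalOnFibreTopHalving` (`HalvingStepTop`), def-P11's `Sect2.printedPlaqs` (FILE 8), `Sect2.coDivSum` ∕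
`Sect2.coDivTerm` ∕ `Sect2.CoDivSmallOn` (FILE 9), `Sect2.SeqSeparated`, `Sect2.enlT` (11b), dag-n07-e 33b `Sect2.bondsDeep`, `cover_add_e` ∕
`cover_sub_e` (`Node00.TorusCoverGaugeLift`), r11∕r12 `B14DomainGeom.(enl, IdxNear, idxNear_of_within)`, `B15Eq112TorusCover.cover`.
`--kind definition --supports stmt-QuantumFields-20541`.  [15] = [Balaban1985Variational]; [6] = [Balaban1985RegularSpaces]; [III] = [Balaban1988Convergent].

WHY.  Print proves the one-step improvement of Sect. F (p. 304: *«hence U_k belongs to the space (2) with max{B₃ε₁, ½ε₀} instead of ε₀»*)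
by an ANALYSIS (axial gauge, [6] Thm 2's gauge (152), the equation (158), the `H`-kernel bounds (161)–(164)) around every unit cube
`Δ₀ ⊂ B_j(Λ_j)`.  On the record's top-domain reading (def-P11 FILE 12a: class and conclusion on `Sect2.omegaPlaqsTop ∕ omegaBondsTop`, scale `0`
on the support `Ω₀ = Sup ν K s.Ω`) a part of the conclusion (2) concerns plaquettes and bonds the analysis never touches: the level-`0`
plaquettes all of whose bonds are PINNED to the datum (`U = W₀` on the bonds meeting `Γ₀ = Ω₁ᶜ`, [III] (2.10)–(2.12)) — def-P11's printed range
`Sect2.printedPlaqs s.Ω k 0` («no bond inside Ω₁») —, and the level-`0` bonds whose whole co-divergence stencil lies off `Ω₁` (33b's `Sect2.bondsDeep (Ω₁)ᶜ`).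
There (2) follows from the data hypothesis (7) (`Sect2.DataSmall7PTop`) DIRECTLY, with the floor `2L² ≤ B₃` of the registered stub (a level-`1` corner
plaquette of `Ω₁` is pinned data of size `δ₀ ≤ 2δ₁`, to be `< B₃δ₁·L⁻²`) — no gauge, no `H`, no collar.  This file NAMES the remaining, genuine
obligation — `HalvingStepTopCore` —, so that Sect.-F dischargers (plan v3 sub-targets S1–S6) and the ∃-gauge letter tokens of the S6 assembly need
not produce gauges around pure-data plaquettes; the implication `Core ⇒ HalvingStepTop` (data bookkeeping + `SeqSeparated`) is the Summits-side
sequel `Summit.…Theorems.K0HalvingStepOfCore` (it reads the K0 road's level-`0` dictionary `…K0VariationalThm1OuterRange` by name).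

CONTENTS.  §1 generic torus bookkeeping: `Sect2.shift_mem_enlT_one` ∕ `Sect2.unshift_mem_enlT_one` (a nearest neighbour of a point of `Y` lies in
`Y^{∼1}` for any cube side `s ≥ 1`), `Sect2.SeqSeparated.shift_mem` ∕ `.unshift_mem` (print's separation read pointwise: `x ∈ Ω_{n+1} ⇒ x ± e_μ ∈ Ω_n`);
§2 the co-divergence stencil: `Sect2.norm_coDivTerm_le_of_plaqs`, ★ `Sect2.norm_coDivSum_le_of_stencil` (dag-n07-e A1's `norm_coDivSum_le` with the
`2d` STENCIL plaquettes of the bond only — [6] (1.2) is a sum over directions of differences of two conjugated plaquette variables);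
§3 ★★ `HalvingStepTopCore F N Sup B₃ a₀ a₁` (NAMED FACT, never asserted: `HalvingStepTop`'s binder block BYTE FOR BYTE, conclusion restricted to
`p ∉ Sect2.printedPlaqs s.Ω k 0` ∕ `b ∉ Sect2.bondsDeep (s.Ω 1)ᶜ`), `HalvingStepTopCore.of_le`, `halvingStepTopCore_of_halvingStepTop` (restriction).

HONEST FRAMING: one named fact (a `Prop`, never asserted) + kernel bookkeeping on a finite torus; NOTHING of Bałaban's analysis is proved;
`stub_prop8StepCoP13` ∕ K0⁷ NOT closed; N07 NOT discharged; counts unmoved (5∕27); one finite T⁴ programme at fixed ε — NOT continuum ∕ ℝ⁴ ∕ OS ∕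
mass gap ∕ Clay.  READING displayed (unchanged from modules 30∕p524052): criticality in the CURVE form.  No `sorry`, no `instance`, no `notation`.
-/

noncomputable section

namespace Literature.MathematicalPhysics.QuantumFieldTheory.Balaban1983to89.Node00

open scoped Matrix.Norms.L2Operator
open T4Continuum (T4Family)
open B15DeterminingSets
open B15Eq112TorusCover (cover)
open B14DomainGeom (Pt enl IdxNear Within idxNear_of_within)
open B7Prop1Explicit (e)

/-! ## §1  Torus bookkeeping: nearest neighbours under `Y^{∼1}` and under print's separation of the sequence -/

section Neighbours

variable {P : Params}

/-- On the cover, a unit step stays within sup-distance `s` for every cube side `s ≥ 1`, hence within ONE layer of `s`-cubes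
(r11's `IdxNear s 1`). [cite: Balaban1988Convergent, (2.1)–(2.3) pp.254–255 (bookkeeping)] -/
theorem Sect2.idxNear_add_e {s : ℕ} (hs : 0 < s) (x : Pt P.d) (μ : Fin P.d) : IdxNear s 1 (x + e μ) x := by
  refine idxNear_of_within s 1 hs (fun i => ?_)
  have hs1 : (1 : ℤ) ≤ ((1 : ℕ) : ℤ) * (s : ℤ) := by
    have : (1 : ℤ) ≤ s := by exact_mod_cast hs
    simpa using this
  refine le_trans ?_ hs1
  simp only [Pi.add_apply, B7Prop1Explicit.e_apply, add_sub_cancel_left]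
  split_ifs <;> simp

/-- On the cover, a backward unit step stays within ONE layer of `s`-cubes, `s ≥ 1`. [cite: Balaban1988Convergent, (2.1)–(2.3) pp.254–255 (bookkeeping)] -/
theorem Sect2.idxNear_sub_e {s : ℕ} (hs : 0 < s) (x : Pt P.d) (μ : Fin P.d) : IdxNear s 1 (x - e μ) x := by
  have h := (Sect2.idxNear_add_e (P := P) hs (x - e μ) μ).symm
  rwa [sub_add_cancel] at h

/-- **A FORWARD NEIGHBOUR OF `Y` LIES IN `Y^{∼1}`** (11b's `Sect2.enlT P s 1 Y`, any cube side `s ≥ 1`): `y ∈ Y ⇒ y + e_μ ∈ Y^{∼1}`.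
[cite: Balaban1988Convergent, (2.1)–(2.3) pp.254–255; Balaban1985RegularSpaces, (1.3)–(1.4) p.77 (bookkeeping)] -/
theorem Sect2.shift_mem_enlT_one {s : ℕ} (hs : 0 < s) {Y : Set (Site P 0)} {y : Site P 0} (hy : y ∈ Y) (μ : Fin P.d) :
    y.shift μ ∈ Sect2.enlT P s 1 Y := by
  obtain ⟨x, rfl⟩ := B15Eq112TorusCover.cover_surjective (P := P) y
  refine (Sect2.mem_enlT_iff s 1 Y _).2 ⟨x + e μ, ⟨x, hy, Sect2.idxNear_add_e hs x μ⟩, cover_add_e x μ⟩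

/-- **A BACKWARD NEIGHBOUR OF `Y` LIES IN `Y^{∼1}`**: `y ∈ Y ⇒ y − e_μ ∈ Y^{∼1}`, any cube side `s ≥ 1`.
[cite: Balaban1988Convergent, (2.1)–(2.3) pp.254–255; Balaban1985RegularSpaces, (1.3)–(1.4) p.77 (bookkeeping)] -/
theorem Sect2.unshift_mem_enlT_one {s : ℕ} (hs : 0 < s) {Y : Set (Site P 0)} {y : Site P 0} (hy : y ∈ Y) (μ : Fin P.d) :
    y.unshift μ ∈ Sect2.enlT P s 1 Y := by
  obtain ⟨x, rfl⟩ := B15Eq112TorusCover.cover_surjective (P := P) y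
  refine (Sect2.mem_enlT_iff s 1 Y _).2 ⟨x - e μ, ⟨x, hy, Sect2.idxNear_sub_e hs x μ⟩, cover_sub_e x μ⟩

/-- **PRINT'S SEPARATION READ POINTWISE, forward step**: along a separated (2.18) index (`Sect2.SeqSeparated M₁ s`, `0 < M₁`), every forward
nearest neighbour of a point of `Ω_{n+1}` lies in `Ω_n` (`1 ≤ n < k`) — [6] (1.4) «(L^jη)⁻¹dist(Ω_j^c, Ω_{j+1}) ≥ RM₁» costs at least one lattice
step. [cite: Balaban1985RegularSpaces, (1.3)–(1.4) p.77; Balaban1988Convergent, p.256] -/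
theorem Sect2.SeqSeparated.shift_mem {M₁ : ℕ} {D : ℕ → Set (Set (Site P 0))} {k : ℕ} {s : B14.Eq218Concrete.Seq D k}
    (hsep : Sect2.SeqSeparated M₁ s) (hM₁ : 0 < M₁) {n : ℕ} (hn1 : 1 ≤ n) (hnk : n < k) {x : Site P 0} (hx : x ∈ s.Ω (n + 1))
    (μ : Fin P.d) : x.shift μ ∈ s.Ω n :=
  hsep n hn1 hnk (Sect2.shift_mem_enlT_one (Nat.mul_pos (pow_pos P.L_pos _) hM₁) hx μ)

/-- **PRINT'S SEPARATION READ POINTWISE, backward step**: `x ∈ Ω_{n+1} ⇒ x − e_μ ∈ Ω_n` (`1 ≤ n < k`, `0 < M₁`).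
[cite: Balaban1985RegularSpaces, (1.3)–(1.4) p.77; Balaban1988Convergent, p.256] -/
theorem Sect2.SeqSeparated.unshift_mem {M₁ : ℕ} {D : ℕ → Set (Set (Site P 0))} {k : ℕ} {s : B14.Eq218Concrete.Seq D k}
    (hsep : Sect2.SeqSeparated M₁ s) (hM₁ : 0 < M₁) {n : ℕ} (hn1 : 1 ≤ n) (hnk : n < k) {x : Site P 0} (hx : x ∈ s.Ω (n + 1))
    (μ : Fin P.d) : x.unshift μ ∈ s.Ω n :=
  hsep n hn1 hnk (Sect2.unshift_mem_enlT_one (Nat.mul_pos (pow_pos P.L_pos _) hM₁) hx μ)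

end Neighbours

/-! ## §2  The co-divergence stencil: `‖η·(D^{η*}_U∂U)(b)‖` is bounded by the deviations of the `2d` plaquettes containing `b` -/

section Stencil

variable {P : Params} {j : ℕ} {N : ℕ} [NeZero N]

/-- One term of [6] (1.2) bounded by ITS TWO plaquettes: `‖R(U(x,x−e_ν))(∂U)(p_{αβ}(x−e_ν)) − (∂U)(p_{αβ}(x))‖ ≤ |U(∂p_{αβ}(x−e_ν)) − 1| +
|U(∂p_{αβ}(x)) − 1|` (unitary conjugation preserves `|· − 1|`; dag-n07-e A1's `norm_coDivTerm_le` with the global plaquette bound replaced by the two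
stencil plaquettes). [cite: Balaban1985RegularSpaces, (1.1)–(1.2) p.76 (bookkeeping)] -/
theorem Sect2.norm_coDivTerm_le_of_plaqs (U : GaugeField P j (SU N)) (x : Site P j) (ν α β : Fin P.d) (hαβ : α < β) :
    ‖Sect2.coDivTerm U x ν α β hαβ‖ ≤
      dist1 (GaugeField.plaqHol U ⟨x.unshift ν, α, β, hαβ⟩) + dist1 (GaugeField.plaqHol U ⟨x, α, β, hαβ⟩) := by
  unfold Sect2.coDivTerm Sect2.plaqMat
  simp only [coe_ιSU]
  set g : SU N := U ⟨x.unshift ν, ν⟩ with hg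
  set q₁ : SU N := GaugeField.plaqHol U ⟨x.unshift ν, α, β, hαβ⟩ with hq₁
  set q₂ : SU N := GaugeField.plaqHol U ⟨x, α, β, hαβ⟩ with hq₂
  have hA : ((g⁻¹ : SU N) : MatA N) * (q₁ : MatA N) * (g : MatA N) = ((g⁻¹ * q₁ * g : SU N) : MatA N) := rfl
  rw [hA]
  calc ‖((g⁻¹ * q₁ * g : SU N) : MatA N) - (q₂ : MatA N)‖
      ≤ ‖((g⁻¹ * q₁ * g : SU N) : MatA N) - 1‖ + ‖(1 : MatA N) - (q₂ : MatA N)‖ := norm_sub_le_norm_sub_add_norm_sub _ _ _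
    _ = dist1 (g⁻¹ * q₁ * g) + dist1 q₂ := by rw [norm_sub_rev (1 : MatA N)]; rfl
    _ = dist1 q₁ + dist1 q₂ := by
        rw [show g⁻¹ * q₁ * g = g⁻¹ * q₁ * (g⁻¹)⁻¹ by rw [inv_inv], GaugeGroup.dist1_conj]

/-- ★ **THE CO-DIVERGENCE IS BOUNDED BY ITS STENCIL**: if every plaquette `p_{αβ}(x)` and `p_{αβ}(x − e_ν)` through the bond `⟨x, x+e_μ⟩`
(`{α, β} = {ν, μ}`, `ν ≠ μ`) has `|U(∂p) − 1| ≤ m`, then `‖η·(D^{η*}_U∂U)(x, x+e_μ)‖ ≤ d·(2m)` (def-P11's `Sect2.coDivSum`: a sum over the `d`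
directions of terms of norm `≤ 2m`, the term `ν = μ` being `0`).  The plaquettes NOT through the bond are not read.
[cite: Balaban1985RegularSpaces, (1.1)–(1.2) p.76, (1.9) p.77 (bookkeeping)] -/
theorem Sect2.norm_coDivSum_le_of_stencil (U : GaugeField P j (SU N)) {m : ℝ} (hm0 : 0 ≤ m) (x : Site P j) (μ : Fin P.d)
    (hlo : ∀ ν : Fin P.d, ∀ h : ν < μ,
      dist1 (GaugeField.plaqHol U ⟨x.unshift ν, ν, μ, h⟩) ≤ m ∧ dist1 (GaugeField.plaqHol U ⟨x, ν, μ, h⟩) ≤ m)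
    (hhi : ∀ ν : Fin P.d, ∀ h : μ < ν,
      dist1 (GaugeField.plaqHol U ⟨x.unshift ν, μ, ν, h⟩) ≤ m ∧ dist1 (GaugeField.plaqHol U ⟨x, μ, ν, h⟩) ≤ m) :
    ‖Sect2.coDivSum U x μ‖ ≤ P.d * (2 * m) := by
  unfold Sect2.coDivSum
  calc ‖∑ ν : Fin P.d, (if h : ν < μ then Sect2.coDivTerm U x ν ν μ h
          else if h' : μ < ν then -Sect2.coDivTerm U x ν μ ν h' else 0)‖
      ≤ ∑ ν : Fin P.d, ‖(if h : ν < μ then Sect2.coDivTerm U x ν ν μ h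
          else if h' : μ < ν then -Sect2.coDivTerm U x ν μ ν h' else 0)‖ := norm_sum_le _ _
    _ ≤ ∑ _ν : Fin P.d, 2 * m := Finset.sum_le_sum fun ν _ => by
        by_cases h1 : ν < μ
        · rw [dif_pos h1]
          have h := Sect2.norm_coDivTerm_le_of_plaqs U x ν ν μ h1
          have h' := hlo ν h1
          linarith [h'.1, h'.2]
        · rw [dif_neg h1]
          by_cases h2 : μ < ν
          · rw [dif_pos h2, norm_neg]
            have h := Sect2.norm_coDivTerm_le_of_plaqs U x ν μ ν h2
            have h' := hhi ν h2
            linarith [h'.1, h'.2]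
          · rw [dif_neg h2, norm_zero]; linarith
    _ = P.d * (2 * m) := by rw [Finset.sum_const, Finset.card_univ, Fintype.card_fin, nsmul_eq_mul]

end Stencil

/-! ## §3  ★★ The CORE form of Sect. F's one-step improvement — the named fact — and its algebra -/

section NamedFactCore

variable (F : T4Family) (N : ℕ) [NeZero N]

/-- ★★ **[15] SECT. F's ONE-STEP IMPROVEMENT AT THE OBJECTS OF RECORD, CORE FORM** (p. 304 [28]: *«we conclude that U′_k satisfies (2) on Δ₀ with
max{B₃ε₁, ½ε₀} instead of ε₀.  The cube Δ₀ is an arbitrary cube Δ(y) = B^j(y), if y ∈ Λ_j, hence U_k belongs to the space (2) with max{B₃ε₁, ½ε₀}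
instead of ε₀»*, for *«critical configurations of the functional (5) … [in] the spaces (6)»*, p. 300) — dag-n07-e's `HalvingStepTop F N Sup B₃ a₀ a₁`
(module 30) BINDER FOR BINDER (separated (2.18) index, `0 < ν.M₁`, `1 ≤ k`; data `W` with print's (7) on the top-domain concord range, thresholds
`0 < δ_n ≤ a₁` comparable BOTH ways; class radii `B₃δ_n ≤ ε_n ≤ a₀` comparable both ways; `U` in the class (6) ON `Ω₀ = Sup ν K s.Ω`, on the fibre
of `W`, CRITICAL for (5) on that fibre), with the CONCLUSION — (1.7) at `max{B₃δ_n, ½ε_n}·η_n²`, (1.9) at `max{B₃δ_n, ½ε_n}·η_n³` — asked ONLY at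
the plaquettes of `Sect2.omegaPlaqsTop` with a bond inside `Ω₁` (`p ∉ Sect2.printedPlaqs s.Ω k 0`, def-P11 FILE 8: NOT pinned data) and at the bonds
of `Sect2.omegaBondsTop` whose co-divergence stencil meets `Ω₁` (`b ∉ Sect2.bondsDeep (s.Ω 1)ᶜ`, 33b) — the plaquettes and bonds where print's
analysis (axial gauge, (152), (158), (161)–(167)) acts.  The complement (pinned level-`0` plaquettes and far bonds) is DATA, discharged Summits-side
(`K0HalvingStepOfCore.halvingStepTop_of_core`, floor `2L² ≤ B₃`).  A `Prop`, NEVER asserted; `a₀` plays print's `a₅`.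
-- TODO(general form): ONE threshold ε₁ and ONE radius ε₀ in print; general admissible `{Ω_j}` ∕ `𝔅_k` of [6] Sect. A; print's (82) tangent criticality.
[cite: Balaban1985Variational, Sect. F pp.300–304, (144) p.300, (166)–(168) p.304, Prop. 8 p.304, (2)–(8) pp.278–279; Balaban1985RegularSpaces, (1.5),(1.7)–(1.9) p.77; Balaban1988Convergent, (2.6)–(2.8) pp.255–256, (2.10)–(2.12) p.256] -/
def HalvingStepTopCore (Sup : (ν : Stage7Numerics) → (K : ℕ) → (ℕ → Set (Site (F.P K) 0)) → Set (Site (F.P K) 0)) (B₃ a₀ a₁ : ℝ) : Prop :=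
  ∀ (ν : Stage7Numerics) (M : ℕ) (g : ℕ → ℝ) (K k : ℕ) (s : SeqOfRecord F ν M g K k), Sect2.SeqSeparated ν.M₁ s → 0 < ν.M₁ → 1 ≤ k →
    ∀ (ε δ : ℕ → ℝ),
    (∀ n, n ≤ k → 0 < δ n ∧ δ n ≤ a₁) → (∀ n, n < k → δ n ≤ 2 * δ (n + 1)) → (∀ n, n < k → δ (n + 1) ≤ 2 * δ n) →
    (∀ n, n ≤ k → B₃ * δ n ≤ ε n ∧ ε n ≤ a₀) → (∀ n, n < k → ε n ≤ 2 * ε (n + 1)) → (∀ n, n < k → ε (n + 1) ≤ 2 * ε n) →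
    ∀ W : MSField (F.P K) (SU N), Sect2.DataSmall7PTop (avOfRecord F N K) s.Ω (Sup ν K s.Ω) k δ W →
      ∀ U : GaugeField (F.P K) 0 (SU N),
        (∀ n, n ≤ k → PlaqSmallOn (Sect2.omegaPlaqsTop s.Ω (Sup ν K s.Ω) n) (ε n * (F.P K).eta n ^ 2) U) →
        (∀ n, n ≤ k → Sect2.CoDivSmallOn (Sect2.omegaBondsTop s.Ω (Sup ν K s.Ω) n) (ε n * (F.P K).eta n ^ 3) U) →
        AgreeOn (genSet s.Ω k) (avgFamily (avOfRecord F N K) U) W →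
        IsCritOnFibre F N K (genSet s.Ω k) W U →
        (∀ n, n ≤ k → ∀ p ∈ Sect2.omegaPlaqsTop s.Ω (Sup ν K s.Ω) n, p ∉ Sect2.printedPlaqs s.Ω k 0 →
            dist1 (GaugeField.plaqHol U p) < max (B₃ * δ n) (ε n / 2) * (F.P K).eta n ^ 2) ∧
          ∀ n, n ≤ k → ∀ b ∈ Sect2.omegaBondsTop s.Ω (Sup ν K s.Ω) n, b ∉ Sect2.bondsDeep (s.Ω 1)ᶜ →
            ‖Sect2.coDivSum U b.src b.dir‖ < max (B₃ * δ n) (ε n / 2) * (F.P K).eta n ^ 3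

variable {F N}

/-- The core one-step fact is antitone in the ceilings `a₀`, `a₁`. [cite: Balaban1985Variational, p.304 before Prop. 8 (bookkeeping)] -/
theorem HalvingStepTopCore.of_le {Sup : (ν : Stage7Numerics) → (K : ℕ) → (ℕ → Set (Site (F.P K) 0)) → Set (Site (F.P K) 0)} {B₃ a₀ a₀' a₁ a₁' : ℝ}
    (h : HalvingStepTopCore F N Sup B₃ a₀ a₁) (ha₀ : a₀' ≤ a₀) (ha₁ : a₁' ≤ a₁) : HalvingStepTopCore F N Sup B₃ a₀' a₁' :=
  fun ν M g K k s hsep hM₁ hk ε δ hδ hcomp hcomp' hε hεcomp hεcomp' W h7 U h17 h19 hfib hcrit =>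
    h ν M g K k s hsep hM₁ hk ε δ (fun n hn => ⟨(hδ n hn).1, (hδ n hn).2.trans ha₁⟩) hcomp hcomp'
      (fun n hn => ⟨(hε n hn).1, (hε n hn).2.trans ha₀⟩) hεcomp hεcomp' W h7 U h17 h19 hfib hcrit

/-- **RESTRICTION**: the full one-step fact (module 30) implies its core form — forget the conclusion at the pure-data plaquettes and bonds.  (The
converse, `Core ⇒ HalvingStepTop` under `2L² ≤ B₃` and `Ω₁ ⊆ Ω₀`, is the Summits-side `K0HalvingStepOfCore.halvingStepTop_of_core`.)
[cite: Balaban1985Variational, Sect. F p.304 (bookkeeping)] -/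
theorem halvingStepTopCore_of_halvingStepTop {Sup : (ν : Stage7Numerics) → (K : ℕ) → (ℕ → Set (Site (F.P K) 0)) → Set (Site (F.P K) 0)}
    {B₃ a₀ a₁ : ℝ} (h : HalvingStepTop F N Sup B₃ a₀ a₁) : HalvingStepTopCore F N Sup B₃ a₀ a₁ := by
  intro ν M g K k s hsep hM₁ hk ε δ hδ hcomp hcomp' hε hεcomp hεcomp' W h7 U h17 h19 hfib hcrit
  obtain ⟨hP, hD⟩ := h ν M g K k s hsep hM₁ hk ε δ hδ hcomp hcomp' hε hεcomp hεcomp' W h7 U h17 h19 hfib hcrit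
  exact ⟨fun n hn p hp _ => hP n hn p hp, fun n hn b hb _ => hD n hn b hb⟩

end NamedFactCore

end Literature.MathematicalPhysics.QuantumFieldTheory.Balaban1983to89.Node00

end
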